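import Summits.CriticalPhenomena.Ising3DConformalLimit.Theses.PrimaryAtInfinity

/-!
# CriticalPhenomena / Ising3DConformalLimit — route PrimaryAtInfinity, assembly

Settles item `stmt-CriticalPhenomena-5358` (rank 1, assembly of route
`route-CriticalPhenomena-PrimaryAtInfinity`):

`FirstMultipoleIdentity → FarFieldClustering → TwoPointPowerLawEta → ExistsRegularLimit →
MultipoleToWard → WardToMoebius → IsingEuclidUpgradeR4NonGaussian → Ising3DConformalLimit`.

Pure logic plus `linarith` over the summit's structure predicates
(`Literature/Probability/LatticeModels/ConformalCovariance.lean`,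
`Literature/Probability/LatticeModels/ScalingLimit3D.lean`): take `(ρ, S)` with its
normalisation, non-degeneracy, translation/parity invariance and continuity from (E)
`ExistsRegularLimit`; (2PT) `TwoPointPowerLawEta` gives `c > 0`, `Δ > 1/2` and the two-point law;
for each `n`, (M1) `FirstMultipoleIdentity` at level `n + 1` gives far-field coefficients
`(A₀, A₁)` of `S (n + 2)` with their expansion and the first-multipole identity, and (FC)
`FarFieldClustering` at level `n` gives their monopole/dipole clustering; `MultipoleToWard` turns
these into the weak special-conformal Ward identity for every `S n`; `WardToMoebius` gives
`IsMoebiusCovariant Δ S`; the shared item `IsingEuclidUpgradeR4NonGaussian` gives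
`HasNontrivialU4 S`; `0 < Δ` from `1/2 < Δ`; conclude `CritIsing3DConformalLimit`
(= `Ising3DConformalLimit`) with the witness `(ρ, Δ, S)`.
No named facts are used; the theorem is unconditional bookkeeping.
-/

namespace Summit.CriticalPhenomena.Ising3DConformalLimit.Theorems

open Summit.CriticalPhenomena.Ising3DConformalLimit.Theses.PrimaryAtInfinity
open Literature.Probability.LatticeModels

/-- Settles `stmt-CriticalPhenomena-5358` (exact signature): the assembly
`FirstMultipoleIdentity → FarFieldClustering → TwoPointPowerLawEta → ExistsRegularLimit →
MultipoleToWard → WardToMoebius → IsingEuclidUpgradeR4NonGaussian → Ising3DConformalLimit`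
of route PrimaryAtInfinity. Proof: `(ρ, S)` from (E); `(c, Δ)` with `c > 0`, `Δ > 1/2` and the
two-point law from (2PT); for every `n`, (M1) at level `n + 1` and (FC) at level `n` feed
`MultipoleToWard`, giving the weak special-conformal Ward identities; `WardToMoebius` gives
Möbius covariance with weight `Δ` (Di Francesco–Mathieu–Sénéchal 1997 §4.2–4.3);
the shared non-Gaussianity item gives `U₄ ≢ 0`; `0 < Δ` by `linarith`. [folklore] -/
theorem primaryAtInfinity_assembly_proof :
    Summit.CriticalPhenomena.Ising3DConformalLimit.Theses.PrimaryAtInfinity.Assembly := by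
  unfold Assembly
  intro h₁ h₂ h₃ h₄ h₅ h₆ h₇
  obtain ⟨ρ, S, hρ, hlim, hnorm, hnd, htrans, hpar, hcont⟩ := h₄
  obtain ⟨c, Δ, hc, hΔ, h2pt⟩ := h₃ ρ S hρ hlim hnd
  have hward := h₅ S c Δ hc.ne' hcont (fun n => by
    obtain ⟨A₀, A₁, hexp, hid⟩ := h₁ ρ S c Δ hρ hlim hnorm hc h2pt (n + 1)
    obtain ⟨hmono, hdip⟩ := h₂ ρ S c Δ hρ hlim hnorm hc h2pt n A₀ A₁ hexp
    exact ⟨A₀, A₁, hexp, hid, hmono, hdip⟩)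
  have hΔpos : (0 : ℝ) < Δ := by linarith
  have hmoeb : IsMoebiusCovariant Δ S := h₆ S Δ hnorm hcont htrans hpar hward
  have hU4 : HasNontrivialU4 S := h₇ ρ S hρ hlim hnd
  exact ⟨ρ, Δ, S, hρ, hΔpos, hlim, hnd, hmoeb, hU4⟩

end Summit.CriticalPhenomena.Ising3DConformalLimit.Theorems
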